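import Summits.QuantumFields.BalabanUV.Beta.CapWordListGLSchedules

/-!
# Beta / CapWordListGL79 — THE LANE'S FUNCTIONAL `G_L` IN ITS ENGINE BASIS: cap3-g19's machine-readable word list `GL_words.v1.json`
# (sha16 b1dcf80811d69979; 79 words over 34 PURE stencil-table letters) typed VERBATIM in cap3's «an5_form», and the CROSS-READ against the
# composite-letter transcription `CapWordListGL.wordListGL` (β sub-cell, BINDER-OWNERS row CAP-k, lineage `b2b-balaban-beta-an5`, gen 27;
# node BETA-an5-g27-COEFF, leaf 5; answers beta-cap-ref #91 «cross-read of the SIGN CONVENTIONS of `wordListGL` PENDING»)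

SOURCE OF RECORD.  `HOME/b2b-balaban-beta-cap3/g19/words/GL_words.v1.json` (schema cap3-GL-words/v1; capsplit_job 2c3b4f2bb8c86658, tables5
47dfd685871385fa, dumps k0 de8f3d880fd7cb05 ∕ st 1607da4925d276d4), converted by `HOME/b2b-balaban-beta-an5-g27/bin/mk_gl79.py` (asserts the JSON
sha16) — NO hand transcription.  cap3's conventions (quoted from the JSON): «G_L(q) = Σ_w (coef_times2∕2)·tr(X L₁ X L₂ ⋯ X L_deg), X = k₀(q)⁻¹;
letters T[(tier, tag, (kc, p))](q) = Σ_R m_R e^{iR·q} (kc: 1 = s, 2 = t, 3 = st; p bitmask 1 = p₁, 2 = p₂), weight R1∕R2∕R1R2 = the same stencil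
with m_R·R_{μ1} ∕ R_{μ2} ∕ R_{μ1}R_{μ2}; K: tag-summed (A+D) weighted (0,0) tables k1, k2, k12; an5_form: letters = REAL-coefficient stencils (odd-p
tables divided by i; weights WITHOUT the scalar), c_w = coef_real_times2 ∕ 2 ∈ {±½}; A = k₀».

* §1 the alphabet `Letter79` (`T tier tag kc p w` ∣ `k1` ∣ `k2` ∣ `k12`) and **`wordListGL79z`** = the 79 (coef_real_times2, letters) pairs of the JSON,
  in the JSON's order; `wordListGL79` (coefficients halved, real); KERNEL-DECIDED shape facts = the JSON's `counts` block: 79 words, degrees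
  1∕2∕3∕4 = 3∕40∕28∕8, coefficients ±1, 34 distinct letters, 0 or 2 «i-carrying» letters per word (odd-p tables and k1∕k2).
* §2 **`gL79 A T := wordSum A T wordListGL79`** and the typed targets **`rowsGL79_ofSchedulesQ_ofPairedBall`** (+`_k₀`; generic leaf certificate,
  any currency) — via gen 27 leaf 3's `rowsOfWordSumCode16E_ofSchedulesQ_ofPairedBall`.

THE CROSS-READ (an5-g27, mechanical; script + this file's `decide`s): mapping each JSON letter `T R x 1 p w` to the composite source-jet letter
`Letter.ks (p ∨ w) x` of `CapWordListGL`, `T R y 2 b none ↦ Letter.kt b y`, `T L x 3 3 ↦ Letter.kst x`, `kᵢ ↦ kᵢ`: (i) the 79 JSON words land on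
51 of the 102 composite words; the other 51 composite words are exactly those containing a C-tagged component absent from the JSON (the `C =
−λ·Hess c` tables have only their `p₁p₂` component: zero letters) — consistent; (ii) on the 51 common words the coefficient of the LEADING
component (pure table `p = a`, no weight) agrees with `wordListGL`'s coefficient for 31 words and is OPPOSITE for 20 — precisely the words with an
ODD number of K letters; i.e. the two lists define THE SAME functional iff the K letters are read `k̃₁ = −i·k₁`, `k̃₂ = −i·k₂` (`CapWordListGL`'s
«T̃ := −i·T» applied to the code's `k₁ = −i·(R₁-weighted table)` gives MINUS the weighted table) and `k̃₁₂ = k₁₂ = −(R₁R₂-weighted table)`, versus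
cap3's an5_form «weights WITHOUT the scalar» (PLUS the weighted tables).  No discrepancy in the functional; a letter-CONVENTION difference confined to
the sign of the three K letters, now pinned by typing the engine basis itself; (iii) the composite source jets read, in an5_form letters:
`k̃s₁ = T̃(1,p₁) − R₁·T(1,0)`, `k̃s₂ = T̃(1,p₂) − R₂·T(1,0)`, `k̃s₃ = T(1,p₁p₂) + R₁·T̃(1,p₂) + R₂·T̃(1,p₁) − R₁R₂·T(1,0)` (relative signs read off the
JSON, uniform over tags and partner letters).  For the (N) binder the ENGINE-BASIS list `wordListGL79` is the one to instantiate (each letter = ONE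
typed table); `wordListGL` remains the composite presentation under the dictionary (iii) + the K-sign reading (ii).

HONEST FRAMING.  Bookkeeping of the lane's FINITE lattice functional (CAP-KERNEL §4.22) as kernel DATA; the G-an2-4 ∕ (N) identification with
Bałaban's coefficient is NOT asserted; no number; 0 binders of the real row instantiated; 0 certified coefficients; discharging `BetaPertH` would make
Bałaban's ultraviolet stability UNCONDITIONAL — NOT the continuum limit, NOT the Clay problem.  HONEST DEPENDENCY: continuum YM on T⁴ ⇐ BetaPertH ∧
nine spine estimates (0∕9 proved); BetaPertH ⇐ (D1) ∧ (D4) ∧ CAP+tail; G-an2-4 gates asym, D1 and NE2∕3∕4.  0 `sorry`, 0 cite tags.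
-/

namespace Summit.QuantumFields.BalabanUV.Beta.CapWordListGL

open Complex Set Matrix
open Literature.MathematicalPhysics.QuantumFieldTheory.Balaban1983to89
open B4Strip (Strip)
open B4ContourShift (latticeKernel)
open B4TorusKernel (descend gridPt)
open Beta.AliasingTailL1 (aliasRatioL1)
open Beta.AliasingTailLattice (codeTheta code16SetE)
open Summit.QuantumFields.BalabanUV.Beta.CapRows (Rows)
open Summit.QuantumFields.BalabanUV.Beta.TubeMaximumModulus
open Summit.QuantumFields.BalabanUV.Beta.VertexToriSymmetry
open Summit.QuantumFields.BalabanUV.Beta.ConjReflectionAlgebra (MatConjSymm)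
open Summit.QuantumFields.BalabanUV.Beta.ResolventBoxCertificate (Box)
open Summit.QuantumFields.BalabanUV.Beta.CoverSchedules
open Summit.QuantumFields.BalabanUV.Beta.ResolventLeafRecord (quarterBoxesQ)
open Summit.QuantumFields.BalabanUV.Beta.CapRouteAWords
open scoped Real Matrix.Norms.L2Operator

/-! ## §1 The engine alphabet and the 79-word list -/

/-- stencil tier: `L` (the `t₁ᴸ` st-stencil) or `R` (the split s∕t stencils). [folklore] -/
inductive Tier
  /-- tier `L`. -/ | L
  /-- tier `R`. -/ | R
  deriving DecidableEq, Repr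

/-- momentum weight of a table: none, `R_{μ1}`, `R_{μ2}`, `R_{μ1}R_{μ2}` (WITHOUT the code's scalar). [folklore] -/
inductive Wt
  /-- unweighted. -/ | none
  /-- weight `R_{μ1}`. -/ | R1
  /-- weight `R_{μ2}`. -/ | R2
  /-- weight `R_{μ1}R_{μ2}`. -/ | R1R2
  deriving DecidableEq, Repr

/-- **THE ENGINE ALPHABET** (cap3 an5_form): `T tier tag kc p w` = the REAL stencil table `T[(tier, tag, (kc, p))]` with weight `w` (odd-p
components divided by `i`); `k1`, `k2`, `k12` = the tag-summed (A+D) `R₁`- ∕ `R₂`- ∕ `R₁R₂`-weighted (0,0) tables (no scalar). [folklore] -/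
inductive Letter79
  /-- stencil table `T[(tier, tag, (kc, p))]` with weight `w`. -/ | T (tier : Tier) (tag : Tag) (kc : Fin 4) (p : Fin 4) (w : Wt)
  /-- `k₁` (R₁-weighted). -/ | k1
  /-- `k₂` (R₂-weighted). -/ | k2
  /-- `k₁₂` (R₁R₂-weighted). -/ | k12
  deriving DecidableEq, Repr

/-- the «i-carrying» letters of the CODE (odd-popcount `p` components, and the single-weight tables `k1`, `k2` ∕ `w = R1, R2`), for the parity
census only — in an5_form every letter is already real. [folklore] -/
def Letter79.icarry : Letter79 → Bool
  | .T _ _ _ p w => (p = 1 ∨ p = 2) != (w = .R1 ∨ w = .R2)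
  | .k1 => true
  | .k2 => true
  | .k12 => false

/-- **THE 79-WORD LIST OF `G_L` OVER `ℤ`** — cap3-g19 `GL_words.v1.json` (b1dcf80811d69979) field `coef_real_times2` + `letters`, in order,
emitted by `mk_gl79.py` (coefficients to be halved). [folklore] -/
def wordListGL79z : List (ℤ × List Letter79) :=
[
  (1, [.T .L .A 3 3 .none]),
  (1, [.T .L .C 3 3 .none]),
  (1, [.T .L .D 3 3 .none]),
  (-1, [.T .R .A 1 0 .none, .T .R .A 2 3 .none]),
  (1, [.T .R .A 1 0 .none, .k1, .T .R .A 2 2 .none]),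
  (1, [.T .R .A 1 0 .none, .k1, .k2, .T .R .A 2 0 .none]),
  (1, [.T .R .A 1 0 .none, .k2, .T .R .A 2 1 .none]),
  (1, [.T .R .A 1 0 .none, .k2, .k1, .T .R .A 2 0 .none]),
  (-1, [.T .R .A 1 0 .none, .k12, .T .R .A 2 0 .none]),
  (1, [.T .R .A 1 1 .none, .T .R .A 2 2 .none]),
  (1, [.T .R .A 1 1 .none, .k2, .T .R .A 2 0 .none]),
  (-1, [.T .R .A 1 0 .R1, .T .R .A 2 2 .none]),
  (-1, [.T .R .A 1 0 .R1, .k2, .T .R .A 2 0 .none]),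
  (1, [.T .R .A 1 2 .none, .T .R .A 2 1 .none]),
  (1, [.T .R .A 1 2 .none, .k1, .T .R .A 2 0 .none]),
  (-1, [.T .R .A 1 0 .R2, .T .R .A 2 1 .none]),
  (-1, [.T .R .A 1 0 .R2, .k1, .T .R .A 2 0 .none]),
  (-1, [.T .R .A 1 3 .none, .T .R .A 2 0 .none]),
  (-1, [.T .R .A 1 2 .R1, .T .R .A 2 0 .none]),
  (-1, [.T .R .A 1 1 .R2, .T .R .A 2 0 .none]),
  (1, [.T .R .A 1 0 .R1R2, .T .R .A 2 0 .none]),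
  (-1, [.T .R .A 1 0 .none, .T .R .C 2 3 .none]),
  (-1, [.T .R .A 1 0 .none, .T .R .D 2 3 .none]),
  (1, [.T .R .A 1 0 .none, .k1, .T .R .D 2 2 .none]),
  (1, [.T .R .A 1 0 .none, .k1, .k2, .T .R .D 2 0 .none]),
  (1, [.T .R .A 1 0 .none, .k2, .T .R .D 2 1 .none]),
  (1, [.T .R .A 1 0 .none, .k2, .k1, .T .R .D 2 0 .none]),
  (-1, [.T .R .A 1 0 .none, .k12, .T .R .D 2 0 .none]),
  (1, [.T .R .A 1 1 .none, .T .R .D 2 2 .none]),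
  (1, [.T .R .A 1 1 .none, .k2, .T .R .D 2 0 .none]),
  (-1, [.T .R .A 1 0 .R1, .T .R .D 2 2 .none]),
  (-1, [.T .R .A 1 0 .R1, .k2, .T .R .D 2 0 .none]),
  (1, [.T .R .A 1 2 .none, .T .R .D 2 1 .none]),
  (1, [.T .R .A 1 2 .none, .k1, .T .R .D 2 0 .none]),
  (-1, [.T .R .A 1 0 .R2, .T .R .D 2 1 .none]),
  (-1, [.T .R .A 1 0 .R2, .k1, .T .R .D 2 0 .none]),
  (-1, [.T .R .A 1 3 .none, .T .R .D 2 0 .none]),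
  (-1, [.T .R .A 1 2 .R1, .T .R .D 2 0 .none]),
  (-1, [.T .R .A 1 1 .R2, .T .R .D 2 0 .none]),
  (1, [.T .R .A 1 0 .R1R2, .T .R .D 2 0 .none]),
  (-1, [.T .R .C 1 3 .none, .T .R .A 2 0 .none]),
  (-1, [.T .R .C 1 3 .none, .T .R .D 2 0 .none]),
  (-1, [.T .R .D 1 0 .none, .T .R .A 2 3 .none]),
  (1, [.T .R .D 1 0 .none, .k1, .T .R .A 2 2 .none]),
  (1, [.T .R .D 1 0 .none, .k1, .k2, .T .R .A 2 0 .none]),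
  (1, [.T .R .D 1 0 .none, .k2, .T .R .A 2 1 .none]),
  (1, [.T .R .D 1 0 .none, .k2, .k1, .T .R .A 2 0 .none]),
  (-1, [.T .R .D 1 0 .none, .k12, .T .R .A 2 0 .none]),
  (1, [.T .R .D 1 1 .none, .T .R .A 2 2 .none]),
  (1, [.T .R .D 1 1 .none, .k2, .T .R .A 2 0 .none]),
  (-1, [.T .R .D 1 0 .R1, .T .R .A 2 2 .none]),
  (-1, [.T .R .D 1 0 .R1, .k2, .T .R .A 2 0 .none]),
  (1, [.T .R .D 1 2 .none, .T .R .A 2 1 .none]),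
  (1, [.T .R .D 1 2 .none, .k1, .T .R .A 2 0 .none]),
  (-1, [.T .R .D 1 0 .R2, .T .R .A 2 1 .none]),
  (-1, [.T .R .D 1 0 .R2, .k1, .T .R .A 2 0 .none]),
  (-1, [.T .R .D 1 3 .none, .T .R .A 2 0 .none]),
  (-1, [.T .R .D 1 2 .R1, .T .R .A 2 0 .none]),
  (-1, [.T .R .D 1 1 .R2, .T .R .A 2 0 .none]),
  (1, [.T .R .D 1 0 .R1R2, .T .R .A 2 0 .none]),
  (-1, [.T .R .D 1 0 .none, .T .R .C 2 3 .none]),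
  (-1, [.T .R .D 1 0 .none, .T .R .D 2 3 .none]),
  (1, [.T .R .D 1 0 .none, .k1, .T .R .D 2 2 .none]),
  (1, [.T .R .D 1 0 .none, .k1, .k2, .T .R .D 2 0 .none]),
  (1, [.T .R .D 1 0 .none, .k2, .T .R .D 2 1 .none]),
  (1, [.T .R .D 1 0 .none, .k2, .k1, .T .R .D 2 0 .none]),
  (-1, [.T .R .D 1 0 .none, .k12, .T .R .D 2 0 .none]),
  (1, [.T .R .D 1 1 .none, .T .R .D 2 2 .none]),
  (1, [.T .R .D 1 1 .none, .k2, .T .R .D 2 0 .none]),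
  (-1, [.T .R .D 1 0 .R1, .T .R .D 2 2 .none]),
  (-1, [.T .R .D 1 0 .R1, .k2, .T .R .D 2 0 .none]),
  (1, [.T .R .D 1 2 .none, .T .R .D 2 1 .none]),
  (1, [.T .R .D 1 2 .none, .k1, .T .R .D 2 0 .none]),
  (-1, [.T .R .D 1 0 .R2, .T .R .D 2 1 .none]),
  (-1, [.T .R .D 1 0 .R2, .k1, .T .R .D 2 0 .none]),
  (-1, [.T .R .D 1 3 .none, .T .R .D 2 0 .none]),
  (-1, [.T .R .D 1 2 .R1, .T .R .D 2 0 .none]),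
  (-1, [.T .R .D 1 1 .R2, .T .R .D 2 0 .none]),
  (1, [.T .R .D 1 0 .R1R2, .T .R .D 2 0 .none])]

/-- **THE 79-WORD LIST OF `G_L`**: real coefficients `c∕2 ∈ {±½}`. [folklore] -/
noncomputable def wordListGL79 : List (ℝ × List Letter79) := wordListGL79z.map fun cw => ((cw.1 : ℝ) / 2, cw.2)

/-- SHAPE = JSON `counts.total`: 79 words. [folklore] -/
theorem length_wordListGL79z : wordListGL79z.length = 79 := by decide

/-- SHAPE = JSON `counts.deg1…deg4`: X-degrees 1∕2∕3∕4 occur 3∕40∕28∕8 times. [folklore] -/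
theorem degrees_wordListGL79z :
    (wordListGL79z.filter fun cw => cw.2.length = 1).length = 3 ∧ (wordListGL79z.filter fun cw => cw.2.length = 2).length = 40 ∧
    (wordListGL79z.filter fun cw => cw.2.length = 3).length = 28 ∧ (wordListGL79z.filter fun cw => cw.2.length = 4).length = 8 := by decide

/-- SHAPE = JSON `counts.coef_real_times2_values`: every integer coefficient is `±1`. [folklore] -/
theorem coeff_wordListGL79z : ∀ cw ∈ wordListGL79z, cw.1 = 1 ∨ cw.1 = -1 := by decide

/-- **THE 34 LETTERS THAT OCCUR** (31 table letters + k1, k2, k12), in order of first occurrence — the list of tables the dictionary must type. [folklore] -/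
def letters79 : List Letter79 :=
  [
  .T .L .A 3 3 .none, .T .L .C 3 3 .none, .T .L .D 3 3 .none, .T .R .A 1 0 .none,
  .T .R .A 2 3 .none, .k1, .T .R .A 2 2 .none, .k2,
  .T .R .A 2 0 .none, .T .R .A 2 1 .none, .k12, .T .R .A 1 1 .none,
  .T .R .A 1 0 .R1, .T .R .A 1 2 .none, .T .R .A 1 0 .R2, .T .R .A 1 3 .none,
  .T .R .A 1 2 .R1, .T .R .A 1 1 .R2, .T .R .A 1 0 .R1R2, .T .R .C 2 3 .none,
  .T .R .D 2 3 .none, .T .R .D 2 2 .none, .T .R .D 2 0 .none, .T .R .D 2 1 .none,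
  .T .R .C 1 3 .none, .T .R .D 1 0 .none, .T .R .D 1 1 .none, .T .R .D 1 0 .R1,
  .T .R .D 1 2 .none, .T .R .D 1 0 .R2, .T .R .D 1 3 .none, .T .R .D 1 2 .R1,
  .T .R .D 1 1 .R2, .T .R .D 1 0 .R1R2]

/-- SHAPE: the alphabet list has 34 entries, no duplicates. [folklore] -/
theorem letters79_length_nodup : letters79.length = 34 ∧ letters79.Nodup := by decide

/-- SHAPE: every letter of every word is one of the 34, and every one of the 34 occurs. [folklore] -/
theorem letters_wordListGL79z :
    (∀ cw ∈ wordListGL79z, ∀ l ∈ cw.2, l ∈ letters79) ∧ (∀ l ∈ letters79, ∃ cw ∈ wordListGL79z, l ∈ cw.2) := by decide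

/-- SHAPE = JSON `counts.i_parity_odd = 0`: every word carries an EVEN number (0 or 2) of i-carrying code letters — the reality census. [folklore] -/
theorem icarry_wordListGL79z : ∀ cw ∈ wordListGL79z,
    (cw.2.filter fun l => l.icarry).length = 0 ∨ (cw.2.filter fun l => l.icarry).length = 2 := by decide

/-- the real list has the same length. [folklore] -/
theorem length_wordListGL79 : wordListGL79.length = 79 := by
  rw [wordListGL79, List.length_map, length_wordListGL79z]

/-! ## §2 `G_L` in the engine basis and its typed target (generic leaf certificate) -/

noncomputable section

variable {n : Type*} [Fintype n] [DecidableEq n]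

/-- **`G_L` IN THE ENGINE BASIS**: `gL79 A T q = Σ_{(c,w) ∈ wordListGL79} c · tr(wordProd A T w q)`, `A = k₀`, `T : Letter79 → _` the 34 real
stencil-table families. [folklore] -/
def gL79 (A : (Fin 4 → ℂ) → Matrix n n ℂ) (T : Letter79 → (Fin 4 → ℂ) → Matrix n n ℂ) (q : Fin 4 → ℂ) : ℂ := wordSum A T wordListGL79 q

variable {b : ℕ → ℝ} {A : (Fin 4 → ℂ) → Matrix n n ℂ} {T : Letter79 → (Fin 4 → ℂ) → Matrix n n ℂ} {κ Ba : ℝ} {S : Letter79 → ℝ}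

/-- **THE TYPED TARGET ON THE ENGINE-BASIS FUNCTIONAL** over (kernel schedule, GENERIC leaf certificate, fin schedules) with the engines' PAIRED
real ball: `rowsOfWordSumCode16E_ofSchedulesQ_ofPairedBall` at `W := wordListGL79`. [folklore] -/
def rowsGL79_ofSchedulesQ_ofPairedBall (hb : b 0 = (latticeKernel (gL79 A T) 0).re) (hκ : 0 < κ)
    (hA : MatTubeHol A (fun _ => κ)) (hT' : ∀ i, MatTubeHol (T i) (fun _ => κ)) (hAn : MatNegTranspose A)
    (hAc : MatConjSymm A) (rT : ∀ i, MatConjSymm (T i))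
    {R : ℚ} (hRπ : π ≤ (R : ℝ)) (ν₀ ν₁ : Fin (3 + 1)) (S' : (Fin (3 + 1) → Bool) → Sched 3)
    (hcert : ∀ bx ∈ quarterBoxesQ (fun _ : Fin (3 + 1) => κ) R ν₀ ν₁ S', ∀ q ∈ Box bx.1 bx.2, IsUnit (A q).det ∧ ‖(A q)⁻¹‖ ≤ Ba)
    (hRfl : ∀ (ν : Fin (3 + 1)) (p : Fin (3 + 1) → ℂ), (A (reflectAt ν p)).det = (A p).det)
    (F : Fin (3 + 1) → Sched 1)
    (hcertF : ∀ (i : Fin (3 + 1)), ∀ bx ∈ finRects (F i), ∀ τ x : ℝ, |τ - bx.1 0| ≤ bx.2 0 → |x - bx.1 1| ≤ bx.2 1 →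
      IsUnit (A (i.insertNth ((x : ℂ) + ((τ * κ : ℝ) : ℂ) * I) fun _ => ((τ * κ : ℝ) : ℂ) * I)).det)
    (hS : ∀ i, ∀ q ∈ VertexTori (fun _ : Fin (3 + 1) => κ), ‖T i q‖ ≤ S i)
    {N : ℕ} (hN : 1 ≤ N) [NeZero (4 * N)] (S₀ Rp : Finset (Fin (3 + 1) → Fin (4 * N)))
    (hdec : code16SetE N = S₀ ∪ Rp ∪ Rp.image (fun w => -w)) (hd₁ : Disjoint S₀ Rp)
    (hd₂ : Disjoint S₀ (Rp.image fun w => -w)) (hd₃ : Disjoint Rp (Rp.image fun w => -w)) {t r : ℝ}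
    (hTpair : |((code16SetE N).card : ℝ)⁻¹ *
        (∑ w ∈ S₀, (descend (gL79 A T) (gridPt (4 * N) w)).re + 2 * ∑ w ∈ Rp, (descend (gL79 A T) (gridPt (4 * N) w)).re) - t| ≤ r)
    {A₀ : ℝ} (hA₀ : wordSumBound n Ba S wordListGL79 * codeTheta (aliasRatioL1 κ N) ≤ A₀) (lo : ℚ)
    (hlo : ((lo : ℚ) : ℝ) ≤ t - r - A₀) : Rows b :=
  rowsOfWordSumCode16E_ofSchedulesQ_ofPairedBall wordListGL79 hb hκ hA hT' hAn hAc rT hRπ ν₀ ν₁ S' hcert hRfl F hcertF hS hN S₀ Rp hdec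
    hd₁ hd₂ hd₃ hTpair hA₀ lo hlo

/-- its level is `k₀ = 0`. [folklore] -/
theorem rowsGL79_ofSchedulesQ_ofPairedBall_k₀ (hb : b 0 = (latticeKernel (gL79 A T) 0).re) (hκ : 0 < κ)
    (hA : MatTubeHol A (fun _ => κ)) (hT' : ∀ i, MatTubeHol (T i) (fun _ => κ)) (hAn : MatNegTranspose A)
    (hAc : MatConjSymm A) (rT : ∀ i, MatConjSymm (T i))
    {R : ℚ} (hRπ : π ≤ (R : ℝ)) (ν₀ ν₁ : Fin (3 + 1)) (S' : (Fin (3 + 1) → Bool) → Sched 3)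
    (hcert : ∀ bx ∈ quarterBoxesQ (fun _ : Fin (3 + 1) => κ) R ν₀ ν₁ S', ∀ q ∈ Box bx.1 bx.2, IsUnit (A q).det ∧ ‖(A q)⁻¹‖ ≤ Ba)
    (hRfl : ∀ (ν : Fin (3 + 1)) (p : Fin (3 + 1) → ℂ), (A (reflectAt ν p)).det = (A p).det)
    (F : Fin (3 + 1) → Sched 1)
    (hcertF : ∀ (i : Fin (3 + 1)), ∀ bx ∈ finRects (F i), ∀ τ x : ℝ, |τ - bx.1 0| ≤ bx.2 0 → |x - bx.1 1| ≤ bx.2 1 →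
      IsUnit (A (i.insertNth ((x : ℂ) + ((τ * κ : ℝ) : ℂ) * I) fun _ => ((τ * κ : ℝ) : ℂ) * I)).det)
    (hS : ∀ i, ∀ q ∈ VertexTori (fun _ : Fin (3 + 1) => κ), ‖T i q‖ ≤ S i)
    {N : ℕ} (hN : 1 ≤ N) [NeZero (4 * N)] (S₀ Rp : Finset (Fin (3 + 1) → Fin (4 * N)))
    (hdec : code16SetE N = S₀ ∪ Rp ∪ Rp.image (fun w => -w)) (hd₁ : Disjoint S₀ Rp)
    (hd₂ : Disjoint S₀ (Rp.image fun w => -w)) (hd₃ : Disjoint Rp (Rp.image fun w => -w)) {t r : ℝ}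
    (hTpair : |((code16SetE N).card : ℝ)⁻¹ *
        (∑ w ∈ S₀, (descend (gL79 A T) (gridPt (4 * N) w)).re + 2 * ∑ w ∈ Rp, (descend (gL79 A T) (gridPt (4 * N) w)).re) - t| ≤ r)
    {A₀ : ℝ} (hA₀ : wordSumBound n Ba S wordListGL79 * codeTheta (aliasRatioL1 κ N) ≤ A₀) (lo : ℚ)
    (hlo : ((lo : ℚ) : ℝ) ≤ t - r - A₀) :
    (rowsGL79_ofSchedulesQ_ofPairedBall hb hκ hA hT' hAn hAc rT hRπ ν₀ ν₁ S' hcert hRfl F hcertF hS hN S₀ Rp hdec hd₁ hd₂ hd₃ hTpair hA₀ lo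
      hlo).k₀ = 0 := rfl

end

end Summit.QuantumFields.BalabanUV.Beta.CapWordListGL
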